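import Summits.NavierStokesRegularity.NavierStokesRegularity.Theorems.TypeILiouvilleTypeIliouvilleNoTypeIIEternalEnergyCesaro
import HarnessLib

/-!
# EEL′ on the TIME-PERIODIC stratum, unconditionally (crux `TypeIliouvilleNoTypeII`,
# stmt-NavierStokesRegularity-0056; rigidity residual EEL′ of the pressure-free eternal split)

Helper file (theorems only).  The pressure-free eternal energy Liouville statement EEL′ — the
`hEEL` binder of `EternalSplit.typeIliouvilleNoTypeII_of_pressureFreeSlab_of_eternalLiouville`: a
bounded eternal Oseen-mild smooth divergence-free `v`, `‖v‖ ≤ 2`, whose Albritton–Barker quantities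
`A`, `C`, `E` are bounded by a finite `I` on ALL parabolic balls, has `v(0,0) = 0` — is OPEN.  The
file `…EternalEnergyLiouvilleSteady.lean` settled it on the steady stratum; this file settles it on
the TIME-PERIODIC stratum (control-lens rider R2 `EELPrimePeriodicStratum` of the §B Type-II cell,
HOME `ns-plan-lens-control-typeII/EELRiders.lean`), with the same elementary mechanism:

* `periodic_fderiv_eq_zero_of_cknE_le` — a jointly smooth TIME-PERIODIC field with
  `E(∇v; Q) ≤ I < ∞` on all parabolic balls has `∇v ≡ 0`: were the dissipation density positive
  near `(t₀, x₀)`, it would exceed some `c > 0` on a window `(t₀-δ, t₀+δ) × B_δ(x₀)` (`2δ ≤ P`) and on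
  all its period-translates; the `m²` translates `k < m²` sit in ONE parabolic ball of radius `m√P`
  (top time `t₀ - δ + m²P`), whose dissipation is `≤ m√P · I` — so `m² c · 2δ|B_δ| ≤ m√P · I` for
  all large `m`, absurd;
* `periodic_eq_zero_of_cknAEss_le_of_cknE_le` — hence constant slices, and the `A`-bound kills the
  constants (`slice_eq_zero_of_const_of_cknAEss_le`): `v ≡ 0`;
* `eternalLiouvillePressureFree_periodic` — **EEL′ on the time-periodic stratum**, in the exact
  `hEEL` hypothesis shape plus a period (the Oseen-mild / divergence-free / `‖v‖ ≤ 2` / `C`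
  hypotheses are accepted and NOT used).

With the steady stratum (p459618) and the active-time density bound
(`tendsto_density_activeTimes_of_cknE_le`), the open core of EEL′ is the TRANSIENT stratum.

WHAT THIS IS NOT: not NS; not a Liouville theorem for time-periodic Navier–Stokes flows (the
`E`-bound hypothesis does all the work — bounded time-periodic mild solutions are objects of KNSS's
open conjecture (L)); EEL′ itself stays OPEN.
-/
noncomputable section

-- the summit and its single problem share the name `NavierStokesRegularity` (D-0017 nested layout)
set_option linter.dupNamespace false

open Set Function Filter Topology MeasureTheory Metric
open scoped NNReal ENNReal

namespace Summit.NavierStokesRegularity.NavierStokesRegularity.Theorems.TypeIliouvilleNoTypeII.TypeIIZoom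

open Literature.Analysis Literature.Analysis.FluidPDE
open Summit.NavierStokesRegularity.NavierStokesRegularity.Theorems.TypeIliouvilleNoTypeII.EternalSplit
  (le_mul_of_inv_mul_le)

variable {v : ℝ → EuclideanSpace ℝ (Fin 3) → EuclideanSpace ℝ (Fin 3)}

/-! ## R2 — the `E`-bound kills the gradient of a time-periodic field -/

/-- Iterating the period: `v(s + kP) = v(s)` for `k : ℕ`. [folklore] -/
theorem periodic_nat_mul {P : ℝ} (hper : ∀ t x, v (t + P) x = v t x) (k : ℕ) (s : ℝ) :
    v (s + k * P) = v s := by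
  induction k with
  | zero => simp
  | succ k ih =>
    funext y
    rw [Nat.cast_succ, add_mul, one_mul, ← add_assoc, hper, ih]

/-- **A uniform bound on the scaled dissipation of a time-periodic jointly smooth field forces
`∇v ≡ 0`.**  If `v(· + P) = v` with `P > 0` and `E((s,y) ↦ ∇v(s)(y); Q_r(z)) ≤ I ≠ ∞` for every
parabolic ball, then `∇v ≡ 0`.  Proof: were `∇v(t₀)(x₀) ≠ 0`, the dissipation density would exceed
some `c > 0` on a window `(t₀-δ, t₀+δ) × B_δ(x₀)` with `2δ ≤ P`, hence on all its period-translates;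
the `m²` translates `k < m²` lie in the parabolic ball of radius `m√P` with top time `t₀-δ+m²P`,
whose dissipation is `≤ m√P · I`; so `m² · c · 2δ|B_δ| ≤ m √P I` for all large `m` — impossible.
[folklore] -/
theorem periodic_fderiv_eq_zero_of_cknE_le (hv : ContDiff ℝ (⊤ : ℕ∞) (uncurry v)) {P : ℝ}
    (hP : 0 < P) (hper : ∀ t x, v (t + P) x = v t x) {I : ℝ≥0∞} (hI : I ≠ ⊤)
    (hE : ∀ r : ℝ, 0 < r → ∀ z : ℝ × EuclideanSpace ℝ (Fin 3),
      cknE r z (fun s y => fderiv ℝ (v s) y) ≤ I)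
    (t₀ : ℝ) (x₀ : EuclideanSpace ℝ (Fin 3)) : fderiv ℝ (v t₀) x₀ = 0 := by
  set g : ℝ × EuclideanSpace ℝ (Fin 3) → ℝ≥0∞ :=
    fun q => ENNReal.ofReal (frobeniusNormSq (fderiv ℝ (v q.1) q.2)) with hg
  have hgc : Continuous g := continuous_dissipationDensity hv
  have hgm : Measurable g := hgc.measurable
  have hgper : ∀ (k : ℕ) (s : ℝ) (y : EuclideanSpace ℝ (Fin 3)), g (s + k * P, y) = g (s, y) := by
    intro k s y
    simp only [hg, periodic_nat_mul hper k s]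
  by_contra hne
  -- ## Step 1: the density exceeds some `c > 0` on a small window around `(t₀, x₀)`
  have hpos : 0 < g (t₀, x₀) := by
    have h1 : 0 < ‖fderiv ℝ (v t₀) x₀‖ := norm_pos_iff.2 hne
    exact ENNReal.ofReal_pos.2 (lt_of_lt_of_le (by positivity) (sq_opNorm_le_frobeniusNormSq _))
  set c : ℝ≥0∞ := g (t₀, x₀) / 2 with hc
  have hc0 : c ≠ 0 := (ENNReal.half_pos hpos.ne').ne'
  obtain ⟨δ₁, hδ₁, hnb⟩ : ∃ δ₁ > 0, ∀ q : ℝ × EuclideanSpace ℝ (Fin 3),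
      dist q (t₀, x₀) < δ₁ → c < g q := by
    have hlt : c < g (t₀, x₀) := ENNReal.half_lt_self hpos.ne' ENNReal.ofReal_ne_top
    have hev : ∀ᶠ q in 𝓝 ((t₀, x₀) : ℝ × EuclideanSpace ℝ (Fin 3)), c < g q :=
      hgc.continuousAt.eventually (lt_mem_nhds hlt)
    obtain ⟨δ₁, hδ₁, h⟩ := Metric.eventually_nhds_iff.1 hev
    exact ⟨δ₁, hδ₁, fun q hq => h hq⟩
  -- the window half-width: small for the neighbourhood AND for disjoint period-translates
  set δ : ℝ := min (δ₁ / 2) (P / 2) with hδdef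
  have hδ : 0 < δ := lt_min (by linarith) (by linarith)
  have hδ₁' : δ < δ₁ := lt_of_le_of_lt (min_le_left _ _) (by linarith)
  have h2δ : 2 * δ ≤ P := by
    have h := min_le_right (δ₁ / 2) (P / 2)
    linarith
  have hwin : ∀ (k : ℕ), ∀ s ∈ Ioo (t₀ - δ + k * P) (t₀ + δ + k * P), ∀ y ∈ ball x₀ δ,
      c < g (s, y) := by
    intro k s hs y hy
    rw [← sub_add_cancel s ((k : ℝ) * P), hgper k]
    apply hnb
    rw [Prod.dist_eq, Real.dist_eq]
    refine max_lt ((abs_sub_lt_iff.2 ⟨?_, ?_⟩).trans hδ₁') ((mem_ball.1 hy).trans hδ₁')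
    · linarith [hs.2]
    · linarith [hs.1]
  -- ## Step 2: one window's worth of dissipation
  set K : ℝ≥0∞ := c * (ENNReal.ofReal (2 * δ) * volume (ball x₀ δ)) with hK
  have hK0 : K ≠ 0 :=
    mul_ne_zero hc0 (mul_ne_zero (by simpa using hδ) (measure_ball_pos volume x₀ hδ).ne')
  have hwinInt : ∀ k : ℕ,
      K ≤ ∫⁻ q in Ioo (t₀ - δ + k * P) (t₀ + δ + k * P) ×ˢ ball x₀ δ, g q := by
    intro k
    have hvol : volume (Ioo (t₀ - δ + k * P) (t₀ + δ + k * P) ×ˢ ball x₀ δ) =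
        ENNReal.ofReal (2 * δ) * volume (ball x₀ δ) := by
      rw [Measure.volume_eq_prod, Measure.prod_prod, Real.volume_Ioo,
        show t₀ + δ + (k : ℝ) * P - (t₀ - δ + (k : ℝ) * P) = 2 * δ by ring]
    calc K = c * volume (Ioo (t₀ - δ + k * P) (t₀ + δ + k * P) ×ˢ ball x₀ δ) := by rw [hK, hvol]
      _ = ∫⁻ _ in Ioo (t₀ - δ + k * P) (t₀ + δ + k * P) ×ˢ ball x₀ δ, c :=
          (setLIntegral_const _ _).symm
      _ ≤ ∫⁻ q in Ioo (t₀ - δ + k * P) (t₀ + δ + k * P) ×ˢ ball x₀ δ, g q :=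
          setLIntegral_mono hgm fun q hq =>
            (hwin k q.1 (mem_prod.1 hq).1 q.2 (mem_prod.1 hq).2).le
  -- ## Step 3: `N` consecutive disjoint windows, by induction
  have hsum : ∀ N : ℕ, (N : ℝ≥0∞) * K ≤
      ∫⁻ q in Ioo (t₀ - δ) (t₀ - δ + (N : ℝ) * P) ×ˢ ball x₀ δ, g q := by
    intro N
    induction N with
    | zero => simp
    | succ N ih =>
      have hdisj : Disjoint (Ioo (t₀ - δ) (t₀ - δ + (N : ℝ) * P) ×ˢ ball x₀ δ)
          (Ioo (t₀ - δ + (N : ℝ) * P) (t₀ + δ + (N : ℝ) * P) ×ˢ ball x₀ δ) := by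
        refine Disjoint.set_prod_left ?_ _ _
        exact disjoint_left.2 fun s hs₁ hs₂ => lt_irrefl _ (hs₁.2.trans hs₂.1)
      have hsub : Ioo (t₀ - δ) (t₀ - δ + (N : ℝ) * P) ×ˢ ball x₀ δ ∪
            Ioo (t₀ - δ + (N : ℝ) * P) (t₀ + δ + (N : ℝ) * P) ×ˢ ball x₀ δ ⊆
          Ioo (t₀ - δ) (t₀ - δ + ((N + 1 : ℕ) : ℝ) * P) ×ˢ ball x₀ δ := by
        rw [← union_prod]
        refine prod_mono (union_subset (Ioo_subset_Ioo_right ?_) (Ioo_subset_Ioo ?_ ?_)) le_rfl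
        · push_cast
          rw [add_mul, one_mul]
          linarith
        · have h0 : (0 : ℝ) ≤ (N : ℝ) * P := by positivity
          linarith
        · push_cast
          rw [add_mul, one_mul]
          linarith
      calc ((N + 1 : ℕ) : ℝ≥0∞) * K = (N : ℝ≥0∞) * K + K := by push_cast; ring
        _ ≤ (∫⁻ q in Ioo (t₀ - δ) (t₀ - δ + (N : ℝ) * P) ×ˢ ball x₀ δ, g q) +
              ∫⁻ q in Ioo (t₀ - δ + (N : ℝ) * P) (t₀ + δ + (N : ℝ) * P) ×ˢ ball x₀ δ, g q :=
            add_le_add ih (hwinInt N)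
        _ = ∫⁻ q in Ioo (t₀ - δ) (t₀ - δ + (N : ℝ) * P) ×ˢ ball x₀ δ ∪
              Ioo (t₀ - δ + (N : ℝ) * P) (t₀ + δ + (N : ℝ) * P) ×ˢ ball x₀ δ, g q :=
            (lintegral_union (measurableSet_Ioo.prod measurableSet_ball) hdisj).symm
        _ ≤ ∫⁻ q in Ioo (t₀ - δ) (t₀ - δ + ((N + 1 : ℕ) : ℝ) * P) ×ˢ ball x₀ δ, g q :=
            lintegral_mono_set hsub
  -- ## Step 4: the `m²` windows `k < m²` sit in ONE parabolic ball, of radius `m √P`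
  set C : ℝ≥0∞ := ENNReal.ofReal (Real.sqrt P) * I with hC
  have hCtop : C ≠ ⊤ := ENNReal.mul_ne_top ENNReal.ofReal_ne_top hI
  have hsP : 0 < Real.sqrt P := Real.sqrt_pos.2 hP
  have hkey : ∀ m : ℕ, δ ≤ (m : ℝ) * Real.sqrt P →
      (m : ℝ≥0∞) * ((m : ℝ≥0∞) * K) ≤ (m : ℝ≥0∞) * C := by
    intro m hm
    have hr : 0 < (m : ℝ) * Real.sqrt P := lt_of_lt_of_le hδ hm
    have hr2 : ((m : ℝ) * Real.sqrt P) ^ 2 = ((m ^ 2 : ℕ) : ℝ) * P := by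
      rw [mul_pow, Real.sq_sqrt hP.le]
      push_cast
      ring
    have hsub : Ioo (t₀ - δ) (t₀ - δ + ((m ^ 2 : ℕ) : ℝ) * P) ×ˢ ball x₀ δ ⊆
        parabolicCylinder ((m : ℝ) * Real.sqrt P) (t₀ - δ + ((m ^ 2 : ℕ) : ℝ) * P, x₀) := by
      simp only [parabolicCylinder]
      rw [hr2, show t₀ - δ + ((m ^ 2 : ℕ) : ℝ) * P - ((m ^ 2 : ℕ) : ℝ) * P = t₀ - δ by ring]
      exact prod_mono le_rfl (ball_subset_ball hm)
    have hEm := hE ((m : ℝ) * Real.sqrt P) hr (t₀ - δ + ((m ^ 2 : ℕ) : ℝ) * P, x₀)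
    have hEm' : (ENNReal.ofReal ((m : ℝ) * Real.sqrt P))⁻¹ *
        ∫⁻ q in parabolicCylinder ((m : ℝ) * Real.sqrt P) (t₀ - δ + ((m ^ 2 : ℕ) : ℝ) * P, x₀),
          g q ≤ I := by
      simpa [cknE, hg] using hEm
    have h1 := (hsum (m ^ 2)).trans ((lintegral_mono_set hsub).trans
      (le_mul_of_inv_mul_le (ENNReal.ofReal_pos.2 hr).ne' ENNReal.ofReal_ne_top hEm'))
    have e1 : ((m ^ 2 : ℕ) : ℝ≥0∞) = (m : ℝ≥0∞) * m := by push_cast; ring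
    have e2 : ENNReal.ofReal ((m : ℝ) * Real.sqrt P) * I = (m : ℝ≥0∞) * C := by
      rw [ENNReal.ofReal_mul (Nat.cast_nonneg m), ENNReal.ofReal_natCast, hC, mul_assoc]
    rw [e1, mul_assoc] at h1
    rwa [e2] at h1
  -- ## Step 5: cancel one factor `m` and let `m → ∞`
  have hev : ∀ᶠ m : ℕ in atTop, (m : ℝ≥0∞) * K ≤ C := by
    have hδev : ∀ᶠ m : ℕ in atTop, δ ≤ (m : ℝ) * Real.sqrt P :=
      (tendsto_natCast_atTop_atTop.atTop_mul_const hsP).eventually_ge_atTop δ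
    filter_upwards [hδev, eventually_gt_atTop 0] with m hm hm0
    have hm0' : (m : ℝ≥0∞) ≠ 0 := by exact_mod_cast hm0.ne'
    exact (ENNReal.mul_le_mul_iff_right hm0' (ENNReal.natCast_ne_top m)).1 (hkey m hm)
  have hlim : Tendsto (fun m : ℕ => (m : ℝ≥0∞) * K) atTop (𝓝 ⊤) := by
    have h := ENNReal.Tendsto.mul_const (ENNReal.tendsto_nat_nhds_top) (Or.inl ENNReal.top_ne_zero)
      (b := K)
    rwa [ENNReal.top_mul hK0] at h
  obtain ⟨m, hm1, hm2⟩ := (hev.and (hlim.eventually_const_lt hCtop.lt_top)).exists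
  exact lt_irrefl C (hm2.trans_le hm1)

/-! ## EEL′ on the time-periodic stratum -/

/-- **Time-periodic jointly smooth fields with bounded `A` and `E` vanish** — the control-lens rider
R2 `EELPrimePeriodicStratum` as a theorem.  If `v` is jointly smooth on `ℝ × ℝ³`, time-periodic with
some period `P > 0`, and its `ess sup` scaled local energy `A_ess(v; Q)` and scaled dissipation
`E(∇v; Q)` are bounded by some finite `I` on every parabolic ball `Q`, then `v ≡ 0`: `∇v ≡ 0` by
`periodic_fderiv_eq_zero_of_cknE_le`, so every slice is constant (`slice_const_of_fderiv_eq_zero`),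
and constants with bounded `A_ess` vanish (`slice_eq_zero_of_const_of_cknAEss_le`). [folklore] -/
theorem periodic_eq_zero_of_cknAEss_le_of_cknE_le (hv : ContDiff ℝ (⊤ : ℕ∞) (uncurry v))
    (hP : ∃ P : ℝ, 0 < P ∧ ∀ t x, v (t + P) x = v t x)
    (hI : ∃ I : ℝ≥0∞, I ≠ ⊤ ∧ ∀ r : ℝ, 0 < r → ∀ z : ℝ × EuclideanSpace ℝ (Fin 3),
      cknAEss r z v ≤ I ∧ cknE r z (fun s y => fderiv ℝ (v s) y) ≤ I)
    (t : ℝ) (x : EuclideanSpace ℝ (Fin 3)) : v t x = 0 := by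
  obtain ⟨P, hP0, hper⟩ := hP
  obtain ⟨I, hItop, hball⟩ := hI
  have h0 : ∀ (s : ℝ) (y : EuclideanSpace ℝ (Fin 3)), fderiv ℝ (v s) y = 0 := fun s y =>
    periodic_fderiv_eq_zero_of_cknE_le hv hP0 hper hItop (fun r hr z => (hball r hr z).2) s y
  have hconst : ∀ (s : ℝ) (y : EuclideanSpace ℝ (Fin 3)), v s y = v s 0 := fun s =>
    slice_const_of_fderiv_eq_zero hv (h0 s)
  have hcont : Continuous fun s => v s 0 :=
    hv.continuous.comp (continuous_id.prodMk continuous_const)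
  exact slice_eq_zero_of_const_of_cknAEss_le hcont hconst hItop (fun r hr z => (hball r hr z).1) t x

variable (v) in
/-- **EEL′ holds on the time-periodic stratum** — in the exact hypothesis shape of
`EternalSplit.typeIliouvilleNoTypeII_of_pressureFreeSlab_of_eternalLiouville` (`hEEL`), restricted to
fields with a time period `P > 0`: such a `v` with `A`, `C`, `E` bounded by a finite `I` on all
parabolic balls has `v(0, 0) = 0` (indeed `v ≡ 0`).  The Oseen-mild, divergence-free and `‖v‖ ≤ 2`
hypotheses and the `C`-clause are part of the shape and are NOT used: as on the steady stratum
(`eternalLiouvillePressureFree_steady`), the energy currency decides by itself.  Bounded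
time-periodic (indeed all bounded ancient) mild solutions are exactly the objects of KNSS's open
conjecture (L); no Liouville theorem for them is claimed here. [cite: KochNadirashviliSereginSverak2009, §1 conjecture (L) p. 3 and the steady case p. 9 (arXiv:0709.3599)] -/
theorem eternalLiouvillePressureFree_periodic
    (hv : ContDiff ℝ (⊤ : ℕ∞) (uncurry v))
    (_hdiv : ∀ t : ℝ, VectorCalculus.IsDivFree (v t))
    (_hmild : ∀ s t : ℝ, s < t → ∀ x, v t x = heatFlow (v s) (t - s) x - oseenDuhamel 1 s v v t x)
    (_hbd : ∀ (t : ℝ) (x : EuclideanSpace ℝ (Fin 3)), ‖v t x‖ ≤ 2)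
    (hI : ∃ I : ℝ≥0∞, I ≠ ⊤ ∧ ∀ r : ℝ, 0 < r → ∀ z : ℝ × EuclideanSpace ℝ (Fin 3),
      cknAEss r z v ≤ I ∧ cknC r z v ≤ I ∧ cknE r z (fun s y => fderiv ℝ (v s) y) ≤ I)
    (hP : ∃ P : ℝ, 0 < P ∧ ∀ t x, v (t + P) x = v t x) : v 0 0 = 0 := by
  obtain ⟨I, hItop, hball⟩ := hI
  exact periodic_eq_zero_of_cknAEss_le_of_cknE_le hv hP
    ⟨I, hItop, fun r hr z => ⟨(hball r hr z).1, (hball r hr z).2.2⟩⟩ 0 0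

end Summit.NavierStokesRegularity.NavierStokesRegularity.Theorems.TypeIliouvilleNoTypeII.TypeIIZoom

end
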